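/-
Copyright (c) 2026 the pub-hodgecm-mathlib formalisation cell (harness21).  Prover seat hodgecm-mathlib-K2E4-p18 (g3), HCML Track B «K2-LIT» ∕ h413
(stmt-HodgeConjecture-24833); line (ii′), sub-letter (H♮), leaf (T2-CPT): FILE 6a — the abstract brick (2026-09-04).
-/
import Literature.NumberTheory.Automorphic.AnisotropicUnitaryGroupCompact      -- ★ unit sphere, coercivity frame, `isCompact_setOf_v_apply_le_exp`
import Literature.NumberTheory.Automorphic.UnitaryGroupOfFormAdelicTopology    -- ★ `isClosed_unitaryGroupOfForm`
import Mathlib.LinearAlgebra.Matrix.Charpoly.Coeff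
import Mathlib.FieldTheory.Minpoly.Field
import HarnessLib

/-!
# K2 · E3 — `Theorems/K2E3JointlyAnisotropicPairCompact.lean` (FILE 6a): THE COMMON ISOMETRY GROUP OF A JOINTLY ANISOTROPIC PAIR OF SESQUILINEAR
# FORMS OVER A DISCRETELY VALUED FIELD WITH COMPACT VALUATION RING IS COMPACT; THE PAIR `(h(x,y), h(x,γy))` OF A NON-DEGENERATE `h` AND A `γ`
# WITHOUT EIGENVECTORS IS JOINTLY ANISOTROPIC

HCML Track B «K2-LIT», cell `pub/hodgecm-mathlib`, crux H413 = `stmt-HodgeConjecture-24833` (lane `--supports … --as helper`); seat `hodgecm-mathlib-K2E4-p18` (g3).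
The abstract half of (T2-CPT) «`Z_{U(Φ₂)_v}(γ)` is compact when `χ_γ` is irreducible» (the last non-★ leaf under (RAY¹) of the (Ψ-package₂¹) letter,
K2E3-plan (g2) 01:04:01Z ∕ K2E5-p12 (g2) 00:55:58Z), in the frame of ★ `AnisotropicUnitaryGroupCompact` (`K` a field with `Valued K ℤᵐ⁰`, a uniformiser
`v ϖ = exp (−1)`, COMPACT `𝒪`, `σ : K →+* K` with `v ∘ σ = v`; `hermForm σ H x y = (σx)ᵀ H y`, `unitaryGroupOfForm σ H = {g | (σg)ᵀ H g = H}`).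

ROAD (no arithmetic, no class field theory, no torus classification).  A pair `(H₁, H₂)` is JOINTLY ANISOTROPIC when `h₁(x,x) = 0 = h₂(x,x) ⇒ x = 0`.
* §1 joint coercivity (`exists_forall_exp_neg_le_or_of_mem_unitSphere`, `exists_forall_v_sq_le_or`): one `m : ℕ` with `v(x_i)²·exp(−m) ≤ v(h₁(x,x))` OR
  `≤ v(h₂(x,x))` for all `x`, `i` — the directed open cover `{¬(v h₁ ≤ exp(−m−1) ∧ v h₂ ≤ exp(−m−1))}` of the compact unit sphere (★ `isCompact_unitSphere`),
  then rescaling by a coordinate of maximal valuation, exactly as ★ `exists_forall_v_sq_le_v_hermForm_self`.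
* §2 boundedness (`exists_forall_v_apply_le_exp_of_mem_of_mem`): the entries of every `g ∈ U(σ,H₁) ∩ U(σ,H₂)` have `v ≤ exp B` (columns have
  `h_k(g e_j, g e_j) = (H_k)_{jj}`).
* §3 **`isCompact_inter_unitaryGroupOfForm`**: `U(σ,H₁) ∩ U(σ,H₂)` is compact (closed ★ `isClosed_unitaryGroupOfForm` inside ★ `isCompact_setOf_v_apply_le_exp`).
* §4 (any commutative ring) `mem_unitaryGroupOfForm_mul_of_commute`: `g ∈ U(σ,H)`, `gγ = γg` ⇒ `g ∈ U(σ, H·γ)` — the centraliser of `γ` in `U(σ,H)`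
  lies in `U(σ,H) ∩ U(σ,Hγ)`.
* §5 (any field, `2 × 2`) `mulVec_ne_smul_of_irreducible_charpoly` (irreducible `χ_γ` ⇒ no eigenvector, Mathlib `Matrix.eval_charpoly`,
  `Matrix.exists_mulVec_eq_zero_iff`, `Polynomial.degree_eq_one_of_irreducible_of_root`) and **`eq_zero_of_hermForm_pair_eq_zero`**: for `H` invertible
  and `γ` without eigenvectors the pair `(H, Hγ)` is jointly anisotropic — `h(x,x) = 0 = h(x,γx)` with `x ≠ 0` makes the functional `h(x,·) = ((σx)ᵀH)·`
  vanish on the basis `{x, γx}`, so `(σx)ᵀ H = 0`, `σ x = 0`, `x = 0`.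

HONEST LABEL: HC_CM is proved only modulo the 7 printed citations (2 remaining named inputs: hLiu418 = stmt-HodgeConjecture-24832, h413 = stmt-HodgeConjecture-24833) until rung 0 closes.
Count-neutral helper toward (T2-CPT) (FILE 6b `Theorems/K2E3RankOneEllipticCentralizerCompact.lean`).  No `sorry`, axioms ⊆ {propext, Classical.choice,
Quot.sound}, no `def`, no instance, no notation.

## References
* [PlatonovRapinchuk1994] V. Platonov, A. Rapinchuk, *Algebraic Groups and Number Theory* (1994), §3.1 Thm. 3.1 (anisotropic ⟺ compact over local fields), §6.2.
* [WeilBNT1967] A. Weil, *Basic Number Theory* (1967), Ch. II §1–§2 (norms on vector spaces over local fields; compact balls).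
* [Rogawski1990] J. D. Rogawski, *Automorphic Representations of Unitary Groups in Three Variables*, Ann. of Math. Stud. 123 (1990), §3.6 Lemma 3.6.1 p. 28
  (the elliptic tori of `U(2)`: `T` anisotropic modulo the compact centre).
-/

set_option autoImplicit false
set_option linter.dupNamespace false

noncomputable section

open scoped Valued WithZero Matrix MatrixGroups
open Matrix Polynomial
open Literature.NumberTheory.Automorphic
open Literature.NumberTheory.Automorphic.HermitianLattice
open Literature.NumberTheory.Automorphic.SymplecticCartan
open Literature.NumberTheory.Automorphic.UnitaryGroup (hermForm hermForm_apply hermForm_mulVec hermForm_smul_left_eq hermForm_single_single)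

namespace Summit.HodgeConjecture.HodgeConjecture.Cruxes.H413.K2E3JointlyAnisotropicPairCompact

section Valued

variable {K : Type*} [Field K] [Valued K ℤᵐ⁰] {ϖ : K}
variable {n : Type*} [Fintype n] [DecidableEq n] {σ : K →+* K} {H₁ H₂ : Matrix n n K}

/-! ## §1 Joint coercivity of a jointly anisotropic pair -/

omit [DecidableEq n] in
/-- **Joint coercivity on the unit sphere**: for `σ` preserving `v`, `𝒪` compact and `(H₁, H₂)` jointly anisotropic there is `m : ℕ` such that every `x`
on the unit sphere has `exp (−m) ≤ v(h₁(x,x))` or `exp (−m) ≤ v(h₂(x,x))`. [cite: PlatonovRapinchuk1994, §3.1 Thm. 3.1] [cite: WeilBNT1967, Ch. II §1 Prop. 2] -/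
theorem exists_forall_exp_neg_le_or_of_mem_unitSphere [CompactSpace 𝒪[K]] (hϖ : Valued.v ϖ = WithZero.exp (-1 : ℤ))
    (hσ : ∀ x, Valued.v (σ x) = Valued.v x) (hanis : ∀ x : n → K, hermForm σ H₁ x x = 0 → hermForm σ H₂ x x = 0 → x = 0) :
    ∃ m : ℕ, ∀ x : n → K, ((∀ i, Valued.v (x i) ≤ 1) ∧ ∃ i, Valued.v (x i) = 1) →
      WithZero.exp (-(m : ℤ)) ≤ Valued.v (hermForm σ H₁ x x) ∨ WithZero.exp (-(m : ℤ)) ≤ Valued.v (hermForm σ H₂ x x) := by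
  have hq₁ : Continuous fun x : n → K => hermForm σ H₁ x x := continuous_hermForm_self (continuous_of_forall_v_eq hσ) H₁
  have hq₂ : Continuous fun x : n → K => hermForm σ H₂ x x := continuous_hermForm_self (continuous_of_forall_v_eq hσ) H₂
  let U : ℕ → Set (n → K) := fun m =>
    {x | ¬ (Valued.v (hermForm σ H₁ x x) ≤ WithZero.exp (-(m : ℤ) - 1) ∧ Valued.v (hermForm σ H₂ x x) ≤ WithZero.exp (-(m : ℤ) - 1))}
  have hUo : ∀ m, IsOpen (U m) := fun m =>
    (((isClosed_setOf_v_le_exp_int hϖ (-(m : ℤ) - 1)).preimage hq₁).inter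
      ((isClosed_setOf_v_le_exp_int hϖ (-(m : ℤ) - 1)).preimage hq₂)).isOpen_compl
  have hmono : Monotone U := by
    intro m m' hmm' x hx hx'
    exact hx ⟨hx'.1.trans (WithZero.exp_le_exp.2 (by omega)), hx'.2.trans (WithZero.exp_le_exp.2 (by omega))⟩
  have hcover : {x : n → K | (∀ i, Valued.v (x i) ≤ 1) ∧ ∃ i, Valued.v (x i) = 1} ⊆ ⋃ m, U m := by
    rintro x ⟨-, i, hi⟩
    have hx0 : x ≠ 0 := by
      rintro rfl
      rw [Pi.zero_apply, map_zero] at hi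
      exact zero_ne_one hi
    -- one of the two values is non-zero
    have hne : hermForm σ H₁ x x ≠ 0 ∨ hermForm σ H₂ x x ≠ 0 := by
      by_contra h
      rw [not_or, not_not, not_not] at h
      exact hx0 (hanis x h.1 h.2)
    rcases hne with h0 | h0
    · have hne' : Valued.v (hermForm σ H₁ x x) ≠ 0 := (Valuation.ne_zero_iff _).2 h0
      set k : ℤ := WithZero.log (Valued.v (hermForm σ H₁ x x)) with hk_def
      have hk : Valued.v (hermForm σ H₁ x x) = WithZero.exp k := (WithZero.exp_log hne').symm
      refine Set.mem_iUnion.2 ⟨(-k).toNat, ?_⟩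
      intro hx'
      have h1 := hx'.1
      rw [hk, WithZero.exp_le_exp] at h1
      have := Int.self_le_toNat (-k)
      omega
    · have hne' : Valued.v (hermForm σ H₂ x x) ≠ 0 := (Valuation.ne_zero_iff _).2 h0
      set k : ℤ := WithZero.log (Valued.v (hermForm σ H₂ x x)) with hk_def
      have hk : Valued.v (hermForm σ H₂ x x) = WithZero.exp k := (WithZero.exp_log hne').symm
      refine Set.mem_iUnion.2 ⟨(-k).toNat, ?_⟩
      intro hx'
      have h2 := hx'.2
      rw [hk, WithZero.exp_le_exp] at h2
      have := Int.self_le_toNat (-k)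
      omega
  obtain ⟨m, hm⟩ := (isCompact_unitSphere (n := n) hϖ).elim_directed_cover U hUo hcover (Monotone.directed_le hmono)
  refine ⟨m, fun x hx => ?_⟩
  have hxU : ¬ (Valued.v (hermForm σ H₁ x x) ≤ WithZero.exp (-(m : ℤ) - 1) ∧
      Valued.v (hermForm σ H₂ x x) ≤ WithZero.exp (-(m : ℤ) - 1)) := hm hx
  rcases not_and_or.1 hxU with h | h
  · left
    have hx0 : Valued.v (hermForm σ H₁ x x) ≠ 0 := by
      intro h0
      rw [h0] at h
      exact h zero_le
    rw [← WithZero.exp_log hx0, WithZero.exp_le_exp] at h ⊢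
    omega
  · right
    have hx0 : Valued.v (hermForm σ H₂ x x) ≠ 0 := by
      intro h0
      rw [h0] at h
      exact h zero_le
    rw [← WithZero.exp_log hx0, WithZero.exp_le_exp] at h ⊢
    omega

/-- Rescaling step of the coercivity argument: if every coordinate of `x` has valuation `≤ v c` (`c ≠ 0`) and `exp(−m) ≤ v(h(c⁻¹x, c⁻¹x))`, then
`v(x_i)²·exp(−m) ≤ v(h(x,x))` (`h(c⁻¹x, c⁻¹x) = σ(c⁻¹) c⁻¹ h(x,x)`, `v ∘ σ = v`). [cite: WeilBNT1967, Ch. II §1 Prop. 2] -/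
theorem v_sq_mul_exp_neg_le_of_rescaled {H : Matrix n n K} (hσ : ∀ x, Valued.v (σ x) = Valued.v x) {m : ℕ} {x : n → K} {c : K} (hc0 : c ≠ 0)
    (hle : ∀ j, Valued.v (x j) ≤ Valued.v c) (hmy : WithZero.exp (-(m : ℤ)) ≤ Valued.v (hermForm σ H (c⁻¹ • x) (c⁻¹ • x))) (i : n) :
    Valued.v (x i) * Valued.v (x i) * WithZero.exp (-(m : ℤ)) ≤ Valued.v (hermForm σ H x x) := by
  have hvc0 : Valued.v c ≠ 0 := (Valuation.ne_zero_iff _).2 hc0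
  have hqy : hermForm σ H (c⁻¹ • x) (c⁻¹ • x) = σ c⁻¹ * (c⁻¹ * hermForm σ H x x) := by
    rw [hermForm_smul_left_eq, hermForm_smul_right]
  rw [hqy, map_mul, map_mul, hσ, map_inv₀] at hmy
  have key : Valued.v c * Valued.v c * WithZero.exp (-(m : ℤ)) ≤ Valued.v (hermForm σ H x x) := by
    calc Valued.v c * Valued.v c * WithZero.exp (-(m : ℤ))
        ≤ Valued.v c * Valued.v c * ((Valued.v c)⁻¹ * ((Valued.v c)⁻¹ * Valued.v (hermForm σ H x x))) := mul_le_mul' le_rfl hmy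
      _ = Valued.v (hermForm σ H x x) := by
          rw [← mul_assoc, mul_assoc (Valued.v c) (Valued.v c), mul_inv_cancel₀ hvc0, mul_one, mul_inv_cancel_left₀ hvc0]
  exact (mul_le_mul' (mul_le_mul' (hle i) (hle i)) le_rfl).trans key

/-- **JOINT COERCIVITY of a jointly anisotropic pair**: `v(x_i)²·exp(−m) ≤ v(h₁(x,x))` or `≤ v(h₂(x,x))`, for all `x ∈ Kⁿ` and all `i`, with one `m : ℕ`.
[cite: PlatonovRapinchuk1994, §3.1 Thm. 3.1] [cite: WeilBNT1967, Ch. II §1 Prop. 2] -/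
theorem exists_forall_v_sq_le_or [CompactSpace 𝒪[K]] (hϖ : Valued.v ϖ = WithZero.exp (-1 : ℤ))
    (hσ : ∀ x, Valued.v (σ x) = Valued.v x) (hanis : ∀ x : n → K, hermForm σ H₁ x x = 0 → hermForm σ H₂ x x = 0 → x = 0) :
    ∃ m : ℕ, ∀ (x : n → K) (i : n), Valued.v (x i) * Valued.v (x i) * WithZero.exp (-(m : ℤ)) ≤ Valued.v (hermForm σ H₁ x x) ∨
      Valued.v (x i) * Valued.v (x i) * WithZero.exp (-(m : ℤ)) ≤ Valued.v (hermForm σ H₂ x x) := by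
  obtain ⟨m, hm⟩ := exists_forall_exp_neg_le_or_of_mem_unitSphere hϖ hσ hanis
  refine ⟨m, fun x i => ?_⟩
  by_cases hx : x = 0
  · subst hx
    left
    rw [Pi.zero_apply, map_zero, zero_mul, zero_mul]
    exact zero_le
  have hne : (Finset.univ : Finset n).Nonempty := by
    obtain ⟨j, -⟩ := Function.ne_iff.1 hx
    exact ⟨j, Finset.mem_univ j⟩
  obtain ⟨i₀, -, hi₀⟩ := Finset.exists_max_image Finset.univ (fun j => Valued.v (x j)) hne
  set c := x i₀ with hc
  have hc0 : c ≠ 0 := by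
    intro h0
    obtain ⟨j, hj⟩ := Function.ne_iff.1 hx
    have hle : Valued.v (x j) ≤ Valued.v c := hi₀ j (Finset.mem_univ j)
    rw [h0, map_zero, le_zero_iff, Valuation.zero_iff] at hle
    exact hj hle
  have hvc0 : Valued.v c ≠ 0 := (Valuation.ne_zero_iff _).2 hc0
  have hle : ∀ j, Valued.v (x j) ≤ Valued.v c := fun j => hi₀ j (Finset.mem_univ j)
  have hyS : (∀ j, Valued.v ((c⁻¹ • x) j) ≤ 1) ∧ ∃ j, Valued.v ((c⁻¹ • x) j) = 1 := by
    refine ⟨fun j => ?_, ⟨i₀, ?_⟩⟩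
    · rw [Pi.smul_apply, smul_eq_mul, map_mul, map_inv₀]
      calc (Valued.v c)⁻¹ * Valued.v (x j) ≤ (Valued.v c)⁻¹ * Valued.v c := mul_le_mul' le_rfl (hle j)
        _ = 1 := inv_mul_cancel₀ hvc0
    · rw [Pi.smul_apply, smul_eq_mul, map_mul, map_inv₀, ← hc, inv_mul_cancel₀ hvc0]
  rcases hm (c⁻¹ • x) hyS with h | h
  · exact Or.inl (v_sq_mul_exp_neg_le_of_rescaled hσ hc0 hle h i)
  · exact Or.inr (v_sq_mul_exp_neg_le_of_rescaled hσ hc0 hle h i)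

/-! ## §2 Boundedness of `U(σ, H₁) ∩ U(σ, H₂)` -/

/-- **The entries of a common isometry of a jointly anisotropic pair are bounded**: `v(g_{ij}) ≤ exp B` with one `B : ℕ` for every
`g ∈ U(σ,H₁) ∩ U(σ,H₂)`. [cite: PlatonovRapinchuk1994, §3.1 Thm. 3.1] -/
theorem exists_forall_v_apply_le_exp_of_mem_of_mem [CompactSpace 𝒪[K]] (hϖ : Valued.v ϖ = WithZero.exp (-1 : ℤ))
    (hσ : ∀ x, Valued.v (σ x) = Valued.v x) (hanis : ∀ x : n → K, hermForm σ H₁ x x = 0 → hermForm σ H₂ x x = 0 → x = 0) :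
    ∃ B : ℕ, ∀ g : GL n K, g ∈ unitaryGroupOfForm σ H₁ → g ∈ unitaryGroupOfForm σ H₂ →
      ∀ i j, Valued.v ((g : Matrix n n K) i j) ≤ WithZero.exp (B : ℤ) := by
  obtain ⟨m, hm⟩ := exists_forall_v_sq_le_or hϖ hσ hanis
  obtain ⟨M, hM⟩ := exists_forall_v_le_exp_of_isCompact hϖ
    (((Set.finite_range fun j : n => H₁ j j).union (Set.finite_range fun j : n => H₂ j j)).isCompact)
  refine ⟨M + m, fun g hg₁ hg₂ i j => ?_⟩
  have hcol : (g : Matrix n n K) *ᵥ Pi.single j 1 = fun i => (g : Matrix n n K) i j := by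
    ext i'
    simp [Matrix.mulVec, dotProduct, Pi.single_apply]
  have hlen₁ : hermForm σ H₁ (fun i => (g : Matrix n n K) i j) (fun i => (g : Matrix n n K) i j) = H₁ j j := by
    rw [← hcol, hermForm_mulVec σ (mem_unitaryGroupOfForm_iff.1 hg₁), hermForm_single_single]
  have hlen₂ : hermForm σ H₂ (fun i => (g : Matrix n n K) i j) (fun i => (g : Matrix n n K) i j) = H₂ j j := by
    rw [← hcol, hermForm_mulVec σ (mem_unitaryGroupOfForm_iff.1 hg₂), hermForm_single_single]
  have hM₁ : Valued.v (H₁ j j) ≤ WithZero.exp (M : ℤ) := hM _ (Or.inl ⟨j, rfl⟩)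
  have hM₂ : Valued.v (H₂ j j) ≤ WithZero.exp (M : ℤ) := hM _ (Or.inr ⟨j, rfl⟩)
  have h3 : Valued.v ((g : Matrix n n K) i j) * Valued.v ((g : Matrix n n K) i j) * WithZero.exp (-(m : ℤ)) ≤ WithZero.exp (M : ℤ) := by
    rcases hm (fun i => (g : Matrix n n K) i j) i with h | h
    · rw [hlen₁] at h
      exact h.trans hM₁
    · rw [hlen₂] at h
      exact h.trans hM₂
  by_cases h0 : Valued.v ((g : Matrix n n K) i j) = 0
  · rw [h0]; exact zero_le
  · rw [← WithZero.exp_log h0] at h3 ⊢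
    rw [← WithZero.exp_add, ← WithZero.exp_add, WithZero.exp_le_exp] at h3
    rw [WithZero.exp_le_exp]
    push_cast
    omega

/-! ## §3 Compactness of `U(σ, H₁) ∩ U(σ, H₂)` -/

/-- **THE COMMON ISOMETRY GROUP OF A JOINTLY ANISOTROPIC PAIR IS COMPACT** (as a subset of `GL_n(K)`): `σ` preserving `v`, `v ϖ = exp(−1)`, `𝒪` compact,
`h₁(x,x) = 0 = h₂(x,x) ⇒ x = 0`.  Closed (★ `isClosed_unitaryGroupOfForm`, twice) inside the compact set of `g` with `g`, `g⁻¹` bounded (★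
`isCompact_setOf_v_apply_le_exp`). [cite: PlatonovRapinchuk1994, §3.1 Thm. 3.1] -/
theorem isCompact_inter_unitaryGroupOfForm [CompactSpace 𝒪[K]] (hϖ : Valued.v ϖ = WithZero.exp (-1 : ℤ))
    (hσ : ∀ x, Valued.v (σ x) = Valued.v x) (hanis : ∀ x : n → K, hermForm σ H₁ x x = 0 → hermForm σ H₂ x x = 0 → x = 0) :
    IsCompact (((unitaryGroupOfForm σ H₁ : Subgroup (GL n K)) : Set (GL n K)) ∩ ((unitaryGroupOfForm σ H₂ : Subgroup (GL n K)) : Set (GL n K))) := by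
  obtain ⟨B, hB⟩ := exists_forall_v_apply_le_exp_of_mem_of_mem hϖ hσ hanis
  refine (isCompact_setOf_v_apply_le_exp (n := n) hϖ B).of_isClosed_subset
    ((isClosed_unitaryGroupOfForm (continuous_of_forall_v_eq hσ) H₁).inter (isClosed_unitaryGroupOfForm (continuous_of_forall_v_eq hσ) H₂)) ?_
  rintro g ⟨hg₁, hg₂⟩
  exact ⟨hB g hg₁ hg₂, hB g⁻¹ (Subgroup.inv_mem _ hg₁) (Subgroup.inv_mem _ hg₂)⟩

end Valued

/-! ## §4 The centraliser of `γ` in `U(σ, H)` preserves `h(x, γy)` -/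

section Algebra

variable {S : Type*} [CommRing S] {n : Type*} [Fintype n] [DecidableEq n] {σ : S →+* S}

/-- **`g ∈ U(σ,H)` commuting with `γ` lies in `U(σ, H·γ)`**: `(σg)ᵀ (Hγ) g = (σg)ᵀ H g γ = Hγ`. [cite: Rogawski1990, §3.6 p. 28] -/
theorem mem_unitaryGroupOfForm_mul_of_commute {H : Matrix n n S} {g : GL n S} {γ : Matrix n n S}
    (hg : g ∈ unitaryGroupOfForm σ H) (hc : (g : Matrix n n S) * γ = γ * (g : Matrix n n S)) : g ∈ unitaryGroupOfForm σ (H * γ) := by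
  rw [mem_unitaryGroupOfForm_iff] at hg ⊢
  calc ((g : Matrix n n S).map σ)ᵀ * (H * γ) * (g : Matrix n n S) = ((g : Matrix n n S).map σ)ᵀ * H * (γ * (g : Matrix n n S)) := by
        simp only [Matrix.mul_assoc]
    _ = ((g : Matrix n n S).map σ)ᵀ * H * ((g : Matrix n n S) * γ) := by rw [hc]
    _ = ((g : Matrix n n S).map σ)ᵀ * H * (g : Matrix n n S) * γ := by simp only [Matrix.mul_assoc]
    _ = H * γ := by rw [hg]

omit [DecidableEq n] in
/-- `h_{Hγ}(x, y) = h_H(x, γ y)`. [folklore] -/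
theorem hermForm_mul_eq (H γ : Matrix n n S) (x y : n → S) : hermForm σ (H * γ) x y = hermForm σ H x (γ *ᵥ y) := by
  rw [hermForm_apply, hermForm_apply, Matrix.mulVec_mulVec]

end Algebra

/-! ## §5 Joint anisotropy of `(H, Hγ)`: `H` invertible, `γ` without eigenvectors (`2 × 2`, irreducible `χ_γ`) -/

section Field

variable {S : Type*} [Field S] {σ : S →+* S}

/-- **An irreducible characteristic polynomial leaves no eigenvector** (`2 × 2` over a field): `γ x = c x`, `x ≠ 0` would make `c` a root of `χ_γ`
(Mathlib `Matrix.exists_mulVec_eq_zero_iff`, `Matrix.eval_charpoly`), forcing `deg χ_γ = 1` (`Polynomial.degree_eq_one_of_irreducible_of_root`).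
[cite: Rogawski1990, §3.6 Lemma 3.6.1 p. 28] -/
theorem mulVec_ne_smul_of_irreducible_charpoly {γ : Matrix (Fin 2) (Fin 2) S} (hirr : Irreducible γ.charpoly) {x : Fin 2 → S} (hx : x ≠ 0) (c : S) :
    γ *ᵥ x ≠ c • x := by
  intro h
  have hker : (Matrix.scalar (Fin 2) c - γ) *ᵥ x = 0 := by
    rw [Matrix.sub_mulVec, h, Matrix.scalar_apply, ← Matrix.smul_one_eq_diagonal, Matrix.smul_mulVec, Matrix.one_mulVec, sub_self]
  have hdet : (Matrix.scalar (Fin 2) c - γ).det = 0 := Matrix.exists_mulVec_eq_zero_iff.1 ⟨x, hx, hker⟩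
  have hroot : γ.charpoly.IsRoot c := by
    rw [Polynomial.IsRoot, Matrix.eval_charpoly, hdet]
  have hdeg := Polynomial.degree_eq_one_of_irreducible_of_root hirr hroot
  have h2 := Matrix.charpoly_degree_eq_dim γ
  rw [hdeg, Fintype.card_fin] at h2
  exact absurd h2 (by decide)

/-- **The pair `(H, Hγ)` is jointly anisotropic** for `H` invertible and `γ` without eigenvectors: `h(x,x) = 0 = h(x,γx)` with `x ≠ 0` makes the linear
functional `h(x, ·) = ((σx)ᵀ H) · ` vanish on the basis `{x, γx}` of `S²`, so `(σx)ᵀ H = 0`, `σ x = 0`, `x = 0`. [cite: Rogawski1990, §3.6 Lemma 3.6.1 p. 28] -/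
theorem eq_zero_of_hermForm_pair_eq_zero {H : Matrix (Fin 2) (Fin 2) S} (hH : IsUnit H) {γ : Matrix (Fin 2) (Fin 2) S}
    (hγ : ∀ x : Fin 2 → S, x ≠ 0 → ∀ c : S, γ *ᵥ x ≠ c • x) (x : Fin 2 → S)
    (h₁ : hermForm σ H x x = 0) (h₂ : hermForm σ (H * γ) x x = 0) : x = 0 := by
  by_contra hx
  set w : Fin 2 → S := (⇑σ ∘ x) ᵥ* H with hw
  have hw₁ : w ⬝ᵥ x = 0 := by
    rw [hw, ← Matrix.dotProduct_mulVec, ← hermForm_apply]; exact h₁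
  have hw₂ : w ⬝ᵥ (γ *ᵥ x) = 0 := by
    rw [hw, ← Matrix.dotProduct_mulVec, ← hermForm_apply, ← hermForm_mul_eq]; exact h₂
  -- `{x, γ x}` is linearly independent, hence a basis of `S²`
  have hli : LinearIndependent S ![x, γ *ᵥ x] := by
    refine LinearIndependent.pair_iff.2 fun s t hst => ?_
    by_cases ht : t = 0
    · subst ht
      rw [zero_smul, add_zero] at hst
      exact ⟨(smul_eq_zero.1 hst).resolve_right hx, rfl⟩
    · exfalso
      have h1 : t • (γ *ᵥ x) = -(s • x) := eq_neg_of_add_eq_zero_right hst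
      have h2 : γ *ᵥ x = (-(t⁻¹ * s)) • x := by
        calc γ *ᵥ x = t⁻¹ • (t • (γ *ᵥ x)) := by rw [smul_smul, inv_mul_cancel₀ ht, one_smul]
          _ = (-(t⁻¹ * s)) • x := by rw [h1, smul_neg, smul_smul, neg_smul]
      exact hγ x hx _ h2
  have hcard : Fintype.card (Fin 2) = Module.finrank S (Fin 2 → S) := by
    rw [Fintype.card_fin, Module.finrank_fin_fun]
  let b : Module.Basis (Fin 2) S (Fin 2 → S) := basisOfLinearIndependentOfCardEqFinrank hli hcard
  -- the functional `y ↦ w ⬝ y` vanishes on the basis, hence everywhere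
  let f : (Fin 2 → S) →ₗ[S] S :=
    { toFun := fun y => w ⬝ᵥ y
      map_add' := fun y z => dotProduct_add w y z
      map_smul' := fun c y => by rw [dotProduct_smul, smul_eq_mul, RingHom.id_apply, smul_eq_mul] }
  have hf : f = 0 := by
    refine b.ext fun i => ?_
    fin_cases i
    · show w ⬝ᵥ (b 0) = 0
      rw [coe_basisOfLinearIndependentOfCardEqFinrank]
      exact hw₁
    · show w ⬝ᵥ (b 1) = 0
      rw [coe_basisOfLinearIndependentOfCardEqFinrank]
      exact hw₂
  have hw0 : w = 0 := by
    funext i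
    have hfi : f (Pi.single i 1) = 0 := by rw [hf, LinearMap.zero_apply]
    have hfi' : w ⬝ᵥ Pi.single i 1 = 0 := hfi
    rwa [dotProduct_single, mul_one] at hfi'
  -- `H` is invertible: `σ x = 0`, so `x = 0`
  have hinj : Function.Injective fun v : Fin 2 → S => v ᵥ* H := Matrix.vecMul_injective_iff_isUnit.2 hH
  have hσx : (⇑σ ∘ x) = 0 := hinj (by
    show (⇑σ ∘ x) ᵥ* H = (0 : Fin 2 → S) ᵥ* H
    rw [Matrix.zero_vecMul, ← hw, hw0])
  apply hx
  funext i
  have hi := congr_fun hσx i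
  rw [Function.comp_apply, Pi.zero_apply] at hi
  exact (map_eq_zero_iff σ σ.injective).1 hi

/-- **Joint anisotropy of `(H, Hγ)` from an invertible `H` and an irreducible `χ_γ`** (`2 × 2` over a field) — the `hanis` of §1–§3 for the pair
`(h(x,y), h(x,γy))` preserved by the centraliser of `γ` in `U(σ, H)`. [cite: Rogawski1990, §3.6 Lemma 3.6.1 p. 28] -/
theorem eq_zero_of_hermForm_pair_eq_zero_of_irreducible_charpoly {H : Matrix (Fin 2) (Fin 2) S} (hH : IsUnit H) {γ : Matrix (Fin 2) (Fin 2) S}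
    (hirr : Irreducible γ.charpoly) (x : Fin 2 → S) (h₁ : hermForm σ H x x = 0) (h₂ : hermForm σ (H * γ) x x = 0) : x = 0 :=
  eq_zero_of_hermForm_pair_eq_zero hH (fun _ hy c => mulVec_ne_smul_of_irreducible_charpoly hirr hy c) x h₁ h₂

end Field

end Summit.HodgeConjecture.HodgeConjecture.Cruxes.H413.K2E3JointlyAnisotropicPairCompact

end
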